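import Mathlib
import Literature.Analysis.OperatorTheory.Enflo2023.Basic
import Literature.Analysis.OperatorTheory.Enflo2023.Reductions
import Literature.Analysis.OperatorTheory.Enflo2023.Type2Threshold
import Literature.Analysis.OperatorTheory.Enflo2023.TypeDichotomy
import Literature.Analysis.OperatorTheory.Enflo2023.Vy
import Literature.Analysis.InnerProduct.WeakSubsequence
import HarnessLib

/-!
# Enflo 2023, v2 pp.20–21: the type-2 "large `L`" step — no uniform bound on the minimal moves for `L > 7‖B‖D`

Source under adjudication: Per H. Enflo, *On the invariant subspace problem in Hilbert spaces*, arXiv:2305.15442 (v1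
2023, v2 2024), bib key `Enflo2023` — a CLAIMED proof of the invariant subspace problem for operators on a separable
Hilbert space.  This file is part of the kernel-tight typing of the manuscript by the b2b-enflo repair cell
(formaliser 2, Part B: (28)–(47), the limiting argument and the final deduction).  It records what FOLLOWS (proved
implications from the manuscript's displayed hypotheses) and, where a step does not follow, the typed inference
together with its refutation.  NOTHING here asserts that the manuscript's main theorem holds; no declaration concludes
the invariant subspace problem for an arbitrary operator.  Value (BLOCK-2b): theorems / refutations of typed
inferences about a text — not progress on the problem.

EnfloISP — Part B (formaliser 2).  v2 p.7 and pp.20–21 (operators of type 2).  The text: from the definition of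
type 2 choose `y_n` with `⟨y_n/‖y_n‖, u₀⟩ ≥ 1/100` and `|⟨T^j y_n, y_n⟩| ≤ δ_n‖y_n‖²` (`j ≥ m`, `δ_n → 0`); a
subsequence of `y_n/‖y_n‖` converges weakly to `y'_∞`, `y_n/‖y_n‖ = α_n y'_∞ + s_n`, and
(20) `⟨T^j α_n y'_∞, α_n y'_∞⟩ + ⟨T^j s_n, s_n⟩ → 0` (`j ≥ m`), whence for fixed polynomials `p, q`
(21) `⟨p(T) y'_∞, T^{*m} q(T^*) y'_∞⟩ + ⟨p(T) s_n, T^{*m} q(T^*) s_n⟩ → 0`.  On p.21: "Assume then that, for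
every `L`, there exists `M(L)` such that for every `n`, there exists `ℓ'_n(T)`, `‖ℓ'_n(T)‖₂ ≤ M(L)` such that
`‖ℓ'(T)(y₀' + L s_n) − x₀‖ ≤ 0.3`. … the terms of degree larger than `M'` … contribute less than `10⁻²⁰` … For
terms with degree `≤ M'`, by (20), `|⟨Σ a_j T^j y₀', T^{*m}q(T^*) y₀'⟩ + (1/L)⟨Σ a_j T^j (L s_n), T^{*m}q(T^*) s_n⟩|
→ 0` as `n → ∞`.  With `T^{*m} q(T^*) y₀'` near `x₀` this shows that `‖ℓ_n(T)(y₀ + L s_n)‖ > 1 + 1/5`.  This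
contradiction shows the statement above."

The referee record (STEPS.md B17 (i) / S20) had this step UNVERIFIED ("`M(L)` not uniform in `L`").  This file
CLOSES it: the three displayed lines are a valid argument once the limits are made explicit, and the bound they give
is UNIFORM — for every `L > 7‖B‖D` (`B := T^{*m} q(T^*)` with `‖B y₀' − x₀‖ ≤ 1/8`, `‖s_n‖ ≤ D`) and every `M`,
`Good(L)` fails (`largeL_ell2`); the threshold `7‖B‖D` does not involve `M(L)` or the truncation degree, because
the only place the move enters the final inequality is through `‖P y₀'‖ ≤ 1 + r + o(1)`, which comes from
`‖P(y₀' + L s_n) − x₀‖ ≤ r` and weak nullity alone.  Contents: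
* `eq20_of_weakLimit`, `eq20_of_type2` — (20) derived from `Referee.Type2` and a weakly convergent subsequence
  (`α_n` absorbed: we decompose against the weak limit itself, `s_n := z_n − y'_∞ ⇀ 0`, `‖s_n‖ ≤ 2`);
* `eq21_of_eq20` — (21) for polynomial moves `polyOp T N c = Σ_{j≤N} c_j T^j` against `testOp T m K d = Σ d_i (T†)^{m+i}`;
* `largeL_core` — the p.21 mechanism for an abstract move `P` and test operator `B`: `L ≤ 7‖B‖D`;
* `largeL_poly` (compactness of the coefficient ball, degree `≤ N`) and `largeL_ell2` (truncation of `ℓ²` moves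
  `V_v a = Σ a_j T^j v`, `‖T‖ < 1`, tail `≤ ‖T‖^{N+1}‖v‖(1 − ‖T‖²)^{-1/2}‖a‖`) — the statement of p.21;
* `smallL_moves` (p.21 top: `L₀ > 0`) and `type2_threshold_or_NIS` — EITHER a non-trivial closed invariant subspace
  (the `T`-orbit of `y₀'` or the `T†`-orbit of `(T†)^m y₀'` is not dense — the text's tacit dichotomy behind "with
  `T^{*m} q(T^*) y₀'` near `x₀`") OR the threshold `L₀ > 0` of `Type2Threshold.lean` with `Good` instantiated by the
  actual `ℓ²` moves (`MovesBounded`).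
Dictionary: paper `⟨u, v⟩` (linear in `u`) = Mathlib `⟪v, u⟫_ℂ`; `T^*` = `ContinuousLinearMap.adjoint T`; `y₀`, `y₀'`,
`y'_∞` (conflated in the text on p.21) = one vector `y`; "`‖ℓ‖₂`" = the `ℓ²` norm of the coefficient sequence
(`Vy.lean`).  What this file does NOT touch: the sequel (47) and the room claim of p.20 (refuted, `RoomClaim*.lean`) —
the type-2 branch still dies there, not here.
STATUS: CLOSED (zero sorry).
-/

open scoped InnerProductSpace
open Filter Topology RCLike

namespace Literature.Analysis.OperatorTheory.Enflo2023

namespace Type2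

variable {H : Type*} [NormedAddCommGroup H] [InnerProductSpace ℂ H]

/-- `Re((r : ℂ) w) = r · Re w`. [folklore] -/
lemma re_ofReal_mul' (r : ℝ) (w : ℂ) : re ((r : ℂ) * w) = r * re w := by
  simp only [RCLike.re_to_complex, Complex.re_ofReal_mul]

/-! ### Weak nullity through bounded operators -/

/-- If `s n ⇀ 0` then `⟪v, A (s n)⟫ → 0` for every bounded `A` (pass `A` to the other side as an adjoint).
[folklore] -/
lemma tendsto_inner_apply_of_weakNull [CompleteSpace H] (A : H →L[ℂ] H) (s : ℕ → H)
    (hs : ∀ v : H, Tendsto (fun n => ⟪v, s n⟫_ℂ) atTop (𝓝 0)) (v : H) :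
    Tendsto (fun n => ⟪v, A (s n)⟫_ℂ) atTop (𝓝 0) := by
  have h : ∀ n, ⟪v, A (s n)⟫_ℂ = ⟪ContinuousLinearMap.adjoint A v, s n⟫_ℂ := fun n => by
    rw [ContinuousLinearMap.adjoint_inner_left]
  simp_rw [h]
  exact hs _

/-- If `s n ⇀ 0` then `⟪A (s n), v⟫ → 0`. [folklore] -/
lemma tendsto_inner_apply_left_of_weakNull [CompleteSpace H] (A : H →L[ℂ] H) (s : ℕ → H)
    (hs : ∀ v : H, Tendsto (fun n => ⟪v, s n⟫_ℂ) atTop (𝓝 0)) (v : H) :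
    Tendsto (fun n => ⟪A (s n), v⟫_ℂ) atTop (𝓝 0) := by
  have h := tendsto_inner_apply_of_weakNull A s hs v
  have h' : Tendsto (fun n => (starRingEnd ℂ) ⟪v, A (s n)⟫_ℂ) atTop (𝓝 ((starRingEnd ℂ) 0)) :=
    (Complex.continuous_conj.tendsto 0).comp h
  rw [map_zero] at h'
  refine h'.congr fun n => ?_
  exact inner_conj_symm _ _

/-! ### (20) from the type-2 data and a weak limit (v2 p.7) -/

/-- **(20) derived.**  If `z n ⇀ zlim` and `|⟨T^j z_n, z_n⟩| ≤ δ_n → 0` for every `j ≥ m`, then with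
`s n := z n − zlim` (so `s n ⇀ 0`): `⟨T^j zlim, zlim⟩ + ⟨T^j s_n, s_n⟩ → 0` for every `j ≥ m` — the two cross
terms vanish in the limit by weak nullity.  (Paper: `y_n/‖y_n‖ = α_n y'_∞ + s_n`; here `α_n` is absorbed, i.e. we
decompose against the weak limit itself.)  Dictionary: paper `⟨u, v⟩` = Mathlib `⟪v, u⟫_ℂ`. [cite: Enflo2023, v2 p.7, eq. (20)] -/
theorem eq20_of_weakLimit [CompleteSpace H] (T : H →L[ℂ] H) (m : ℕ) (z : ℕ → H) (zlim : H)
    (hweak : ∀ v : H, Tendsto (fun n => ⟪v, z n⟫_ℂ) atTop (𝓝 ⟪v, zlim⟫_ℂ))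
    (δ : ℕ → ℝ) (hδ : Tendsto δ atTop (𝓝 0))
    (h2 : ∀ n j, m ≤ j → ‖⟪z n, (T ^ j) (z n)⟫_ℂ‖ ≤ δ n) (j : ℕ) (hj : m ≤ j) :
    Tendsto (fun n => ⟪zlim, (T ^ j) zlim⟫_ℂ + ⟪z n - zlim, (T ^ j) (z n - zlim)⟫_ℂ) atTop (𝓝 0) := by
  set s : ℕ → H := fun n => z n - zlim with hs_def
  have hs : ∀ v : H, Tendsto (fun n => ⟪v, s n⟫_ℂ) atTop (𝓝 0) := fun v => by
    have h1 : Tendsto (fun n => ⟪v, z n⟫_ℂ - ⟪v, zlim⟫_ℂ) atTop (𝓝 (⟪v, zlim⟫_ℂ - ⟪v, zlim⟫_ℂ)) :=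
      (hweak v).sub_const _
    rw [sub_self] at h1
    refine h1.congr fun n => ?_
    rw [hs_def, inner_sub_right]
  have hexp : ∀ n, ⟪z n, (T ^ j) (z n)⟫_ℂ = (⟪zlim, (T ^ j) zlim⟫_ℂ + ⟪s n, (T ^ j) (s n)⟫_ℂ)
      + (⟪zlim, (T ^ j) (s n)⟫_ℂ + ⟪s n, (T ^ j) zlim⟫_ℂ) := fun n => by
    have hz : z n = zlim + s n := by
      show z n = zlim + (z n - zlim)
      abel
    rw [hz, map_add, inner_add_left, inner_add_right, inner_add_right]
    ring
  have hmain : Tendsto (fun n => ⟪z n, (T ^ j) (z n)⟫_ℂ) atTop (𝓝 0) := by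
    rw [tendsto_zero_iff_norm_tendsto_zero]
    exact squeeze_zero (fun n => norm_nonneg _) (fun n => h2 n j hj) hδ
  have hcross : Tendsto (fun n => ⟪zlim, (T ^ j) (s n)⟫_ℂ + ⟪s n, (T ^ j) zlim⟫_ℂ) atTop (𝓝 0) := by
    have h1 := tendsto_inner_apply_of_weakNull (T ^ j) s hs zlim
    have h2' : Tendsto (fun n => ⟪s n, (T ^ j) zlim⟫_ℂ) atTop (𝓝 0) := by
      have := tendsto_inner_apply_left_of_weakNull (1 : H →L[ℂ] H) s hs ((T ^ j) zlim)
      simpa using this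
    simpa using h1.add h2'
  have h3 : Tendsto (fun n => ⟪z n, (T ^ j) (z n)⟫_ℂ - (⟪zlim, (T ^ j) (s n)⟫_ℂ + ⟪s n, (T ^ j) zlim⟫_ℂ))
      atTop (𝓝 0) := by
    simpa using hmain.sub hcross
  refine h3.congr fun n => ?_
  rw [hexp n]
  ring

/-- **(20) from the definition of type 2** (`Referee.Type2`, v2 p.7), for the chosen unit vector `u₀`: there are
`m ≥ 1`, a vector `y` (the weak limit `y'_∞` of the normalised `y_n`) with `‖y‖ ≤ 1` and `Re⟨y, u₀⟩ ≥ 1/100`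
(hence `y ≠ 0`), and a weakly null sequence `s n` with `‖s n‖ ≤ 2` such that (20) holds:
`⟨T^j y, y⟩ + ⟨T^j s_n, s_n⟩ → 0` for every `j ≥ m`.  Ingredients: normalisation, a weakly convergent
subsequence of the unit vectors `y_n/‖y_n‖` (`Literature.Analysis.InnerProduct.exists_strictMono_tendsto_inner_of_norm_le`),
and `eq20_of_weakLimit`. [cite: Enflo2023, v2 p.7, eq. (20)] -/
theorem eq20_of_type2 [CompleteSpace H] (T : H →L[ℂ] H) (hT2 : Referee.Type2 T) (u₀ : H) (hu₀ : ‖u₀‖ = 1) :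
    ∃ (m : ℕ) (y : H) (s : ℕ → H), 1 ≤ m ∧ ‖y‖ ≤ 1 ∧ (1 / 100 : ℝ) ≤ re ⟪u₀, y⟫_ℂ ∧ y ≠ 0 ∧
      (∀ n, ‖s n‖ ≤ 2) ∧ (∀ v : H, Tendsto (fun n => ⟪v, s n⟫_ℂ) atTop (𝓝 0)) ∧
      ∀ j, m ≤ j → Tendsto (fun n => ⟪y, (T ^ j) y⟫_ℂ + ⟪s n, (T ^ j) (s n)⟫_ℂ) atTop (𝓝 0) := by
  obtain ⟨m, hm, hδ⟩ := hT2 u₀ hu₀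
  -- for δ_n = 1/(n+1) choose y_n
  have hch : ∀ n : ℕ, ∃ y : H, Referee.AngleCond u₀ y ∧
      ∀ j : ℕ, m ≤ j → ‖⟪(⇑T)^[j] y, y⟫_ℂ‖ ≤ (1 / ((n : ℝ) + 1)) * ‖y‖ ^ 2 :=
    fun n => hδ _ (by positivity)
  choose yseq hyseq using hch
  -- normalise
  have hy0 : ∀ n, yseq n ≠ 0 := fun n => (hyseq n).1.1
  have hypos : ∀ n, 0 < ‖yseq n‖ := fun n => norm_pos_iff.2 (hy0 n)
  set z : ℕ → H := fun n => ((‖yseq n‖⁻¹ : ℝ) : ℂ) • yseq n with hz_def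
  have hz_norm : ∀ n, ‖z n‖ = 1 := fun n => by
    rw [hz_def]
    simp only
    rw [norm_smul, Complex.norm_real, Real.norm_of_nonneg (inv_nonneg.2 (norm_nonneg _)),
      inv_mul_cancel₀ (hypos n).ne']
  have hz_re : ∀ n, (1 / 100 : ℝ) ≤ re ⟪u₀, z n⟫_ℂ := fun n => by
    have h := (hyseq n).1.2
    rw [hz_def]
    simp only
    rw [inner_smul_right, re_ofReal_mul']
    have : (1 / 100 : ℝ) = ‖yseq n‖⁻¹ * ((1 / 100 : ℝ) * ‖yseq n‖) := by
      rw [mul_left_comm, inv_mul_cancel₀ (hypos n).ne', mul_one]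
    rw [this]
    have h' : (1 / 100 : ℝ) * ‖yseq n‖ ≤ re ⟪u₀, yseq n⟫_ℂ := by
      rw [RCLike.re_to_complex]; exact h
    exact mul_le_mul_of_nonneg_left h' (inv_nonneg.2 (norm_nonneg _))
  have hz_t2 : ∀ n j, m ≤ j → ‖⟪z n, (T ^ j) (z n)⟫_ℂ‖ ≤ 1 / ((n : ℝ) + 1) := fun n j hj => by
    have h := (hyseq n).2 j hj
    rw [← ContinuousLinearMap.coe_pow'] at h
    rw [hz_def]
    simp only
    rw [map_smul, inner_smul_left, inner_smul_right, Complex.conj_ofReal, ← mul_assoc, norm_mul, norm_mul,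
      Complex.norm_real, Real.norm_of_nonneg (inv_nonneg.2 (norm_nonneg _)), norm_inner_symm]
    have hn2 : ‖yseq n‖⁻¹ * ‖yseq n‖⁻¹ * (1 / ((n : ℝ) + 1) * ‖yseq n‖ ^ 2) = 1 / ((n : ℝ) + 1) :=
      calc ‖yseq n‖⁻¹ * ‖yseq n‖⁻¹ * (1 / ((n : ℝ) + 1) * ‖yseq n‖ ^ 2)
          = 1 / ((n : ℝ) + 1) * (‖yseq n‖⁻¹ * ‖yseq n‖) ^ 2 := by ring
        _ = 1 / ((n : ℝ) + 1) := by rw [inv_mul_cancel₀ (hypos n).ne', one_pow, mul_one]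
    calc ‖yseq n‖⁻¹ * ‖yseq n‖⁻¹ * ‖⟪(T ^ j) (yseq n), yseq n⟫_ℂ‖
        ≤ ‖yseq n‖⁻¹ * ‖yseq n‖⁻¹ * (1 / ((n : ℝ) + 1) * ‖yseq n‖ ^ 2) := by
          exact mul_le_mul_of_nonneg_left h (by positivity)
      _ = 1 / ((n : ℝ) + 1) := hn2
  -- weakly convergent subsequence
  obtain ⟨φ, w, hφ, hw, hweak⟩ :=
    Literature.Analysis.InnerProduct.exists_strictMono_tendsto_inner_of_norm_le (𝕜 := ℂ) (v := z) (M := 1)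
      (fun n => (hz_norm n).le)
  have hw_re : (1 / 100 : ℝ) ≤ re ⟪u₀, w⟫_ℂ :=
    ge_of_tendsto' ((continuous_re.tendsto _).comp (hweak u₀)) fun n => hz_re (φ n)
  have hw0 : w ≠ 0 := by
    intro h0
    rw [h0, inner_zero_right, map_zero] at hw_re
    linarith
  have hδ0 : Tendsto (fun n => 1 / ((φ n : ℝ) + 1)) atTop (𝓝 0) := by
    have h1 : Tendsto (fun n : ℕ => 1 / ((n : ℝ) + 1)) atTop (𝓝 0) := tendsto_one_div_add_atTop_nhds_zero_nat
    exact h1.comp hφ.tendsto_atTop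
  refine ⟨m, w, fun n => z (φ n) - w, hm, hw, hw_re, hw0, fun n => ?_, fun v => ?_, fun j hj => ?_⟩
  · calc ‖z (φ n) - w‖ ≤ ‖z (φ n)‖ + ‖w‖ := norm_sub_le _ _
      _ ≤ 1 + 1 := add_le_add (hz_norm _).le hw
      _ = 2 := by norm_num
  · have h1 : Tendsto (fun n => ⟪v, z (φ n)⟫_ℂ - ⟪v, w⟫_ℂ) atTop (𝓝 (⟪v, w⟫_ℂ - ⟪v, w⟫_ℂ)) :=
      (hweak v).sub_const _
    rw [sub_self] at h1
    refine h1.congr fun n => ?_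
    rw [inner_sub_right]
  · exact eq20_of_weakLimit T m (z ∘ φ) w hweak (fun n => 1 / ((φ n : ℝ) + 1)) hδ0
      (fun n j hj => hz_t2 (φ n) j hj) j hj

/-! ### The p.21 mechanism, abstract form -/

/-- `Re⟪x₀, u⟫ ≥ 1 − r` when `‖x₀‖ = 1` and `‖u − x₀‖ ≤ r`. [folklore] -/
lemma one_sub_le_re_inner {x₀ u : H} {r : ℝ} (hx₀ : ‖x₀‖ = 1) (hu : ‖u - x₀‖ ≤ r) :
    1 - r ≤ re ⟪x₀, u⟫_ℂ := by
  have h1 : ⟪x₀, u⟫_ℂ = ⟪x₀, x₀⟫_ℂ + ⟪x₀, u - x₀⟫_ℂ := by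
    rw [← inner_add_right]; congr 1; abel
  have h2 : re ⟪x₀, x₀⟫_ℂ = 1 := by
    rw [inner_self_eq_norm_sq, hx₀]; norm_num
  have h3 : |re ⟪x₀, u - x₀⟫_ℂ| ≤ r :=
    calc |re ⟪x₀, u - x₀⟫_ℂ| ≤ ‖⟪x₀, u - x₀⟫_ℂ‖ := abs_re_le_norm _
      _ ≤ ‖x₀‖ * ‖u - x₀‖ := norm_inner_le_norm _ _
      _ ≤ 1 * r := by rw [hx₀]; exact mul_le_mul_of_nonneg_left hu zero_le_one
      _ = r := one_mul r
  rw [h1, map_add, h2]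
  have := neg_le_of_abs_le h3
  linarith

/-- **The p.21 contradiction, abstract form.**  Data: `‖x₀‖ = 1`; a weakly null sequence `s n` with `‖s n‖ ≤ D`;
a vector `y`; a "test operator" `B` with `‖B y − x₀‖ ≤ η ≤ 1/8` (paper: `B = T^{*m} q(T^*)`, `B y₀'` near `x₀`);
a "move" `P` (paper: the truncated `ℓ'_n(T)`) satisfying (21) against `B`,
`⟨P y, B y⟩ + ⟨P s_n, B s_n⟩ → 0`, and moving `y + L s_n` to within `r ≤ 1/2` of `x₀` for all large `n`.
Conclusion: `L ≤ 7‖B‖D`.  Proof (the paper's three lines, with the limits made explicit): `Re⟨P y, x₀⟩ ≥ 1 − r − o(1)`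
(weak nullity of `⟨P s_n, x₀⟩`), `‖P y‖² + L²‖P s_n‖² ≤ (1 + r)² + o(1)` (weak nullity of `⟨P y, P s_n⟩`), hence
`|⟨P s_n, B s_n⟩| ≥ 1 − r − η(1 + r) − o(1)` by (21), while `|⟨P s_n, B s_n⟩| ≤ ‖B‖ D ‖P s_n‖ ≤ ‖B‖ D (1 + r + o(1))/L`.
[cite: Enflo2023, v2 p.21] -/
theorem largeL_core [CompleteSpace H] {x₀ y : H} {s : ℕ → H} {D L r η : ℝ} {B P : H →L[ℂ] H}
    (hx₀ : ‖x₀‖ = 1) (hsD : ∀ n, ‖s n‖ ≤ D)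
    (hs : ∀ v : H, Tendsto (fun n => ⟪v, s n⟫_ℂ) atTop (𝓝 0))
    (hB : ‖B y - x₀‖ ≤ η) (hη : η ≤ 1 / 8)
    (h21 : Tendsto (fun n => ⟪B y, P y⟫_ℂ + ⟪B (s n), P (s n)⟫_ℂ) atTop (𝓝 0))
    (hL : 0 ≤ L) (hr : r ≤ 1 / 2)
    (hmove : ∀ᶠ n in atTop, ‖P (y + (L : ℂ) • s n) - x₀‖ ≤ r) :
    L ≤ 7 * (‖B‖ * D) := by
  have hD : 0 ≤ D := (norm_nonneg _).trans (hsD 0)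
  set K : ℝ := ‖B‖ * D with hK_def
  have hK : 0 ≤ K := mul_nonneg (norm_nonneg _) hD
  -- the three scalar sequences that tend to zero
  have hf : Tendsto (fun n => ⟪x₀, P (s n)⟫_ℂ) atTop (𝓝 0) := tendsto_inner_apply_of_weakNull P s hs x₀
  have hg : Tendsto (fun n => ⟪P y, P (s n)⟫_ℂ) atTop (𝓝 0) := tendsto_inner_apply_of_weakNull P s hs (P y)
  have hf' : Tendsto (fun n => ‖⟪x₀, P (s n)⟫_ℂ‖ * L) atTop (𝓝 0) := by
    simpa using hf.norm.mul_const L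
  have hg' : Tendsto (fun n => ‖⟪P y, P (s n)⟫_ℂ‖ * L) atTop (𝓝 0) := by
    simpa using hg.norm.mul_const L
  have e1 : ∀ᶠ n in atTop, ‖⟪x₀, P (s n)⟫_ℂ‖ * L < 1 / 32 := hf'.eventually_lt_const (by norm_num)
  have e2 : ∀ᶠ n in atTop, ‖⟪P y, P (s n)⟫_ℂ‖ * L < 1 / 64 := hg'.eventually_lt_const (by norm_num)
  have e3 : ∀ᶠ n in atTop, ‖⟪B y, P y⟫_ℂ + ⟪B (s n), P (s n)⟫_ℂ‖ < 1 / 32 := by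
    have := h21.norm
    rw [norm_zero] at this
    exact this.eventually_lt_const (by norm_num)
  obtain ⟨n, ⟨⟨hn1, hn2⟩, hn3⟩, hn4⟩ := (((e1.and e2).and e3).and hmove).exists
  -- notation at this `n`
  have hr0 : 0 ≤ r := (norm_nonneg _).trans hn4
  set u : H := P (y + (L : ℂ) • s n) with hu_def
  have hu : u = P y + (L : ℂ) • P (s n) := by rw [hu_def, map_add, map_smul]
  -- (a) Re⟪x₀, P y⟫ ≥ 1 - r - 1/32
  have ha : 1 - r - 1 / 32 ≤ re ⟪x₀, P y⟫_ℂ := by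
    have h1 : 1 - r ≤ re ⟪x₀, u⟫_ℂ := one_sub_le_re_inner hx₀ hn4
    have h2 : re ⟪x₀, u⟫_ℂ = re ⟪x₀, P y⟫_ℂ + L * re ⟪x₀, P (s n)⟫_ℂ := by
      rw [hu, inner_add_right, inner_smul_right, map_add, re_ofReal_mul']
    have h3 : |L * re ⟪x₀, P (s n)⟫_ℂ| ≤ 1 / 32 := by
      rw [abs_mul, abs_of_nonneg hL, mul_comm]
      exact le_trans (mul_le_mul_of_nonneg_right (abs_re_le_norm _) hL) hn1.le
    have h4 := le_abs_self (L * re ⟪x₀, P (s n)⟫_ℂ)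
    linarith
  -- (b) ‖P y‖² + L²‖P s_n‖² ≤ (1 + r)² + 1/32
  have hb : ‖P y‖ ^ 2 + (L * ‖P (s n)‖) ^ 2 ≤ (1 + r) ^ 2 + 1 / 32 := by
    have h1 : ‖u‖ ≤ 1 + r := by
      calc ‖u‖ ≤ ‖x₀‖ + ‖u - x₀‖ := norm_le_norm_add_norm_sub' u x₀
        _ ≤ 1 + r := by rw [hx₀]; linarith
    have h2 : ‖u‖ ^ 2 ≤ (1 + r) ^ 2 := pow_le_pow_left₀ (norm_nonneg _) h1 2
    have h3 : ‖u‖ ^ 2 = ‖P y‖ ^ 2 + 2 * re ⟪P y, (L : ℂ) • P (s n)⟫_ℂ + ‖(L : ℂ) • P (s n)‖ ^ 2 := by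
      rw [hu]; exact @norm_add_sq ℂ _ _ _ _ _ _
    have h4 : ‖(L : ℂ) • P (s n)‖ = L * ‖P (s n)‖ := by
      rw [norm_smul, Complex.norm_real, Real.norm_of_nonneg hL]
    have h5 : re ⟪P y, (L : ℂ) • P (s n)⟫_ℂ = L * re ⟪P y, P (s n)⟫_ℂ := by
      rw [inner_smul_right, re_ofReal_mul']
    have h6 : |L * re ⟪P y, P (s n)⟫_ℂ| ≤ 1 / 64 := by
      rw [abs_mul, abs_of_nonneg hL, mul_comm]
      exact le_trans (mul_le_mul_of_nonneg_right (abs_re_le_norm _) hL) hn2.le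
    have h7 := neg_le_of_abs_le h6
    rw [h3, h4, h5] at h2
    linarith
  -- (c) ‖P y‖ ≤ 1 + r + 1/32
  have hc : ‖P y‖ ≤ 1 + r + 1 / 32 := by
    have h1 : ‖P y‖ ^ 2 ≤ (1 + r + 1 / 32) ^ 2 := by
      nlinarith [sq_nonneg (L * ‖P (s n)‖)]
    exact (pow_le_pow_iff_left₀ (norm_nonneg _) (by linarith) two_ne_zero).1 h1
  -- (d) Re⟪B y, P y⟫ ≥ 71/256
  have hd : (71 / 256 : ℝ) ≤ re ⟪B y, P y⟫_ℂ := by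
    have h1 : ⟪B y, P y⟫_ℂ = ⟪x₀, P y⟫_ℂ - ⟪x₀ - B y, P y⟫_ℂ := by
      rw [inner_sub_left]; ring
    have hη0 : 0 ≤ η := (norm_nonneg _).trans hB
    have h2 : |re ⟪x₀ - B y, P y⟫_ℂ| ≤ 49 / 256 :=
      calc |re ⟪x₀ - B y, P y⟫_ℂ| ≤ ‖⟪x₀ - B y, P y⟫_ℂ‖ := abs_re_le_norm _
        _ ≤ ‖x₀ - B y‖ * ‖P y‖ := norm_inner_le_norm _ _
        _ ≤ η * (1 + r + 1 / 32) := by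
            rw [norm_sub_rev]
            exact mul_le_mul hB hc (norm_nonneg _) hη0
        _ ≤ (1 / 8) * (49 / 32) := by
            exact mul_le_mul hη (by linarith) (by linarith) (by norm_num)
        _ = 49 / 256 := by norm_num
    have h3 := le_abs_self (re ⟪x₀ - B y, P y⟫_ℂ)
    rw [h1, map_sub]
    linarith
  -- (e) ‖⟪B s_n, P s_n⟫‖ ≥ 63/256
  have he : (63 / 256 : ℝ) ≤ ‖⟪B (s n), P (s n)⟫_ℂ‖ := by
    have h1 : re ⟪B y, P y⟫_ℂ + re ⟪B (s n), P (s n)⟫_ℂ < 1 / 32 := by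
      have := abs_re_le_norm (⟪B y, P y⟫_ℂ + ⟪B (s n), P (s n)⟫_ℂ)
      rw [map_add] at this
      have h' := le_abs_self (re ⟪B y, P y⟫_ℂ + re ⟪B (s n), P (s n)⟫_ℂ)
      linarith
    have h2 : re ⟪B (s n), P (s n)⟫_ℂ ≤ -(63 / 256) := by linarith
    calc (63 / 256 : ℝ) ≤ -re ⟪B (s n), P (s n)⟫_ℂ := by linarith
      _ ≤ |re ⟪B (s n), P (s n)⟫_ℂ| := neg_le_abs _
      _ ≤ ‖⟪B (s n), P (s n)⟫_ℂ‖ := abs_re_le_norm _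
  -- (f) ‖⟪B s_n, P s_n⟫‖ ≤ ‖B‖ D ‖P s_n‖
  have hf2 : ‖⟪B (s n), P (s n)⟫_ℂ‖ ≤ K * ‖P (s n)‖ :=
    calc ‖⟪B (s n), P (s n)⟫_ℂ‖ ≤ ‖B (s n)‖ * ‖P (s n)‖ := norm_inner_le_norm _ _
      _ ≤ (‖B‖ * ‖s n‖) * ‖P (s n)‖ := mul_le_mul_of_nonneg_right (B.le_opNorm _) (norm_nonneg _)
      _ ≤ (‖B‖ * D) * ‖P (s n)‖ := by gcongr; exact hsD n
      _ = K * ‖P (s n)‖ := by rw [hK_def]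
  -- (g) X := L ‖P s_n‖ ≤ 38/25
  have hX0 : 0 ≤ L * ‖P (s n)‖ := mul_nonneg hL (norm_nonneg _)
  have hX : L * ‖P (s n)‖ ≤ 38 / 25 := by
    have h1 : (L * ‖P (s n)‖) ^ 2 ≤ (38 / 25 : ℝ) ^ 2 := by
      nlinarith [sq_nonneg ‖P y‖]
    exact (pow_le_pow_iff_left₀ hX0 (by norm_num) two_ne_zero).1 h1
  -- (h) assemble
  have h1 : (63 / 256 : ℝ) * L ≤ K * (L * ‖P (s n)‖) := by
    have := mul_le_mul_of_nonneg_right (he.trans hf2) hL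
    linarith [this]
  have h2 : K * (L * ‖P (s n)‖) ≤ K * (38 / 25) := mul_le_mul_of_nonneg_left hX hK
  nlinarith


/-! ### Polynomial moves and the test operator `T^{*m} q(T^*)` -/

/-- The polynomial move `p(T) = Σ_{j ≤ N} c_j T^j` as a bounded operator (the truncated `ℓ'_n(T)` of v2 p.21).
[cite: Enflo2023, v2 p.21] -/
noncomputable def polyOp (T : H →L[ℂ] H) (N : ℕ) (c : Fin (N + 1) → ℂ) : H →L[ℂ] H :=
  ∑ j : Fin (N + 1), c j • T ^ (j : ℕ)

/-- Unfolding `polyOp`. [cite: Enflo2023, v2 p.21] -/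
lemma polyOp_apply (T : H →L[ℂ] H) (N : ℕ) (c : Fin (N + 1) → ℂ) (v : H) :
    polyOp T N c v = ∑ j : Fin (N + 1), c j • (T ^ (j : ℕ)) v := by
  simp only [polyOp, _root_.sum_apply, _root_.smul_apply]

/-- `c ↦ p_c(T)` is continuous (finite-dimensional coefficient space). [folklore] -/
lemma continuous_polyOp (T : H →L[ℂ] H) (N : ℕ) : Continuous fun c : Fin (N + 1) → ℂ => polyOp T N c := by
  unfold polyOp
  exact continuous_finsetSum _ fun j _ => (continuous_apply j).smul continuous_const

/-- `⟨T^k p(T) v, w⟩` expanded: `⟪w, T^k (p(T) v)⟫ = Σ_j c_j ⟪w, T^{k+j} v⟫`. [folklore] -/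
lemma inner_pow_polyOp_apply (T : H →L[ℂ] H) (N : ℕ) (c : Fin (N + 1) → ℂ) (k : ℕ) (v w : H) :
    ⟪w, (T ^ k) (polyOp T N c v)⟫_ℂ = ∑ j : Fin (N + 1), c j * ⟪w, (T ^ (k + j)) v⟫_ℂ := by
  rw [polyOp_apply, map_sum, inner_sum]
  refine Finset.sum_congr rfl fun j _ => ?_
  rw [map_smul, inner_smul_right, pow_add, mul_apply_eq_comp]

/-- `(T^k)† = (T†)^k`. [folklore] -/
lemma adjoint_pow [CompleteSpace H] (T : H →L[ℂ] H) (k : ℕ) :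
    ContinuousLinearMap.adjoint (T ^ k) = ContinuousLinearMap.adjoint T ^ k := by
  rw [← ContinuousLinearMap.star_eq_adjoint, ← ContinuousLinearMap.star_eq_adjoint, star_pow]

/-- The test operator `T^{*m} q(T^*) = Σ_{i ≤ K} d_i (T†)^{m+i}` of (21) / v2 p.21. [cite: Enflo2023, v2 p.7, eq. (21)] -/
noncomputable def testOp [CompleteSpace H] (T : H →L[ℂ] H) (m K : ℕ) (d : Fin (K + 1) → ℂ) : H →L[ℂ] H :=
  ∑ i : Fin (K + 1), d i • ContinuousLinearMap.adjoint T ^ (m + (i : ℕ))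

/-- `T^{*m} q(T^*) v = q(T†) ((T†)^m v)`. [cite: Enflo2023, v2 p.7, eq. (21)] -/
lemma testOp_apply [CompleteSpace H] (T : H →L[ℂ] H) (m K : ℕ) (d : Fin (K + 1) → ℂ) (v : H) :
    testOp T m K d v = polyOp (ContinuousLinearMap.adjoint T) K d ((ContinuousLinearMap.adjoint T ^ m) v) := by
  rw [testOp, polyOp_apply, _root_.sum_apply]
  refine Finset.sum_congr rfl fun i _ => ?_
  rw [_root_.smul_apply, add_comm, pow_add, mul_apply_eq_comp]

/-- `⟪T^{*m} q(T^*) v, u⟫ = Σ_i conj(d_i) ⟪v, T^{m+i} u⟫`. [cite: Enflo2023, v2 p.7, eq. (21)] -/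
lemma inner_testOp_left [CompleteSpace H] (T : H →L[ℂ] H) (m K : ℕ) (d : Fin (K + 1) → ℂ) (v u : H) :
    ⟪testOp T m K d v, u⟫_ℂ = ∑ i : Fin (K + 1), (starRingEnd ℂ) (d i) * ⟪v, (T ^ (m + i)) u⟫_ℂ := by
  rw [testOp, _root_.sum_apply, sum_inner]
  refine Finset.sum_congr rfl fun i _ => ?_
  rw [_root_.smul_apply, inner_smul_left, ← adjoint_pow, ContinuousLinearMap.adjoint_inner_left]

/-- **(21) from (20)** (v2 p.7: "Equation (20) gives, for fixed `p` and `q`, …"): for every polynomial move `p(T)`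
of degree `≤ N` and the test operator `T^{*m} q(T^*)`,
`⟨p(T) y, T^{*m} q(T^*) y⟩ + ⟨p(T) s_n, T^{*m} q(T^*) s_n⟩ → 0` — a finite linear combination of instances of (20)
with exponents `m + i + j ≥ m`. [cite: Enflo2023, v2 p.7, eq. (21)] -/
theorem eq21_of_eq20 [CompleteSpace H] (T : H →L[ℂ] H) (m : ℕ) {y : H} {s : ℕ → H}
    (h20 : ∀ j, m ≤ j → Tendsto (fun n => ⟪y, (T ^ j) y⟫_ℂ + ⟪s n, (T ^ j) (s n)⟫_ℂ) atTop (𝓝 0))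
    (K : ℕ) (d : Fin (K + 1) → ℂ) (N : ℕ) (c : Fin (N + 1) → ℂ) :
    Tendsto (fun n => ⟪testOp T m K d y, polyOp T N c y⟫_ℂ + ⟪testOp T m K d (s n), polyOp T N c (s n)⟫_ℂ)
      atTop (𝓝 0) := by
  have hexp : ∀ v : H, ⟪testOp T m K d v, polyOp T N c v⟫_ℂ =
      ∑ i : Fin (K + 1), ∑ j : Fin (N + 1), (starRingEnd ℂ) (d i) * c j * ⟪v, (T ^ (m + i + j)) v⟫_ℂ :=
    fun v => by
    rw [inner_testOp_left]
    refine Finset.sum_congr rfl fun i _ => ?_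
    rw [inner_pow_polyOp_apply, Finset.mul_sum]
    refine Finset.sum_congr rfl fun j _ => ?_
    ring
  simp_rw [hexp, ← Finset.sum_add_distrib, ← mul_add]
  have h0 : (0 : ℂ) = ∑ i : Fin (K + 1), ∑ j : Fin (N + 1), (starRingEnd ℂ) (d i) * c j * 0 := by simp
  rw [h0]
  refine tendsto_finsetSum _ fun i _ => tendsto_finsetSum _ fun j _ => ?_
  exact (h20 (m + i + j) (by omega)).const_mul _

/-! ### No uniform bound on polynomial moves for `L > 7‖B‖D` -/

/-- **Large `L`, polynomial moves of bounded degree.**  With the data of `largeL_core`, `‖B y − x₀‖ ≤ 1/8` and (21)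
for `B` against every polynomial move of degree `≤ N`: if `L > 7‖B‖D` there is NO bound `M` such that for every
`n` some move `p_n(T)`, `deg p_n ≤ N`, `‖p_n‖_∞ ≤ M`, takes `y + L s_n` to within `2/5` of `x₀`.  (Compactness of
the coefficient ball gives a subsequence `p_{n_k} → P`; `P` then moves `y + L s_{n_k}` to within `1/2` for all large
`k` and satisfies (21), contradicting `largeL_core`.) [cite: Enflo2023, v2 p.21] -/
theorem largeL_poly [CompleteSpace H] (T : H →L[ℂ] H) {x₀ y : H} {s : ℕ → H} {D L : ℝ} {B : H →L[ℂ] H}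
    (hx₀ : ‖x₀‖ = 1) (hsD : ∀ n, ‖s n‖ ≤ D)
    (hs : ∀ v : H, Tendsto (fun n => ⟪v, s n⟫_ℂ) atTop (𝓝 0))
    (hB : ‖B y - x₀‖ ≤ 1 / 8) (N : ℕ)
    (h21 : ∀ c : Fin (N + 1) → ℂ,
      Tendsto (fun n => ⟪B y, polyOp T N c y⟫_ℂ + ⟪B (s n), polyOp T N c (s n)⟫_ℂ) atTop (𝓝 0))
    (hL : 7 * (‖B‖ * D) < L) (M : ℝ) :
    ¬ ∀ n, ∃ c : Fin (N + 1) → ℂ, ‖c‖ ≤ M ∧ ‖polyOp T N c (y + (L : ℂ) • s n) - x₀‖ ≤ 2 / 5 := by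
  intro hgood
  choose c hcM hc using hgood
  have hD : 0 ≤ D := (norm_nonneg _).trans (hsD 0)
  have hBD : 0 ≤ ‖B‖ * D := mul_nonneg (norm_nonneg _) hD
  have hL0 : 0 ≤ L := by linarith
  obtain ⟨a, -, φ, hφ, hlim⟩ := tendsto_subseq_of_bounded (Metric.isBounded_closedBall (x := (0 : Fin (N + 1) → ℂ))
    (r := M)) (x := c) (fun n => mem_closedBall_zero_iff.2 (hcM n))
  set P : H →L[ℂ] H := polyOp T N a with hP_def
  have hPlim : Tendsto (fun k => polyOp T N (c (φ k))) atTop (𝓝 P) := ((continuous_polyOp T N).tendsto a).comp hlim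
  have hnorm : Tendsto (fun k => ‖polyOp T N (c (φ k)) - P‖) atTop (𝓝 0) :=
    tendsto_iff_norm_sub_tendsto_zero.1 hPlim
  have hvW : ∀ n, ‖y + (L : ℂ) • s n‖ ≤ ‖y‖ + L * D := fun n =>
    calc ‖y + (L : ℂ) • s n‖ ≤ ‖y‖ + ‖(L : ℂ) • s n‖ := norm_add_le _ _
      _ ≤ ‖y‖ + L * D := by
          rw [norm_smul, Complex.norm_real, Real.norm_of_nonneg hL0]
          exact add_le_add le_rfl (mul_le_mul_of_nonneg_left (hsD n) hL0)
  have hev : ∀ᶠ k in atTop, ‖polyOp T N (c (φ k)) - P‖ * (‖y‖ + L * D) < 1 / 10 := by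
    have h := hnorm.mul_const (‖y‖ + L * D)
    rw [zero_mul] at h
    exact h.eventually_lt_const (by norm_num)
  have hmove : ∀ᶠ k in atTop, ‖P (y + (L : ℂ) • s (φ k)) - x₀‖ ≤ 1 / 2 := hev.mono fun k hk => by
    have h1 := hc (φ k)
    have h2 : ‖(polyOp T N (c (φ k)) - P) (y + (L : ℂ) • s (φ k))‖ ≤
        ‖polyOp T N (c (φ k)) - P‖ * (‖y‖ + L * D) :=
      (ContinuousLinearMap.le_opNorm _ _).trans (mul_le_mul_of_nonneg_left (hvW _) (norm_nonneg _))
    have h3 : P (y + (L : ℂ) • s (φ k)) - x₀ =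
        (polyOp T N (c (φ k)) (y + (L : ℂ) • s (φ k)) - x₀) -
          (polyOp T N (c (φ k)) - P) (y + (L : ℂ) • s (φ k)) := by
      rw [_root_.sub_apply]; abel
    calc ‖P (y + (L : ℂ) • s (φ k)) - x₀‖
        ≤ ‖polyOp T N (c (φ k)) (y + (L : ℂ) • s (φ k)) - x₀‖ +
            ‖(polyOp T N (c (φ k)) - P) (y + (L : ℂ) • s (φ k))‖ := by rw [h3]; exact norm_sub_le _ _
      _ ≤ 2 / 5 + 1 / 10 := add_le_add h1 (h2.trans hk.le)
      _ = 1 / 2 := by norm_num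
  have key := largeL_core (s := s ∘ φ) hx₀ (fun n => hsD (φ n)) (fun v => (hs v).comp hφ.tendsto_atTop) hB le_rfl
    ((h21 a).comp hφ.tendsto_atTop) hL0 (le_refl (1 / 2 : ℝ)) hmove
  linarith

/-! ### From polynomial moves to `ℓ²` moves `V_v a = Σ_j a_j T^j v` (`‖T‖ < 1`) -/

/-- `(L^k a)_j = a_{j+k}` for the left shift `L` on `ℓ²`. [folklore] -/
lemma L_pow_apply (a : Vy.ℓ2) (k j : ℕ) : ((Vy.L ^ k) a) j = a (j + k) := by
  induction k generalizing j with
  | zero => simp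
  | succ k ih =>
    rw [pow_succ', mul_apply_eq_comp, Vy.L_apply, ih, show j + 1 + k = j + (k + 1) by omega]

/-- `‖L^k a‖ ≤ ‖a‖`. [folklore] -/
lemma norm_L_pow_apply_le (a : Vy.ℓ2) (k : ℕ) : ‖(Vy.L ^ k) a‖ ≤ ‖a‖ := by
  induction k with
  | zero => simp
  | succ k ih =>
    rw [pow_succ', mul_apply_eq_comp]
    exact (Vy.norm_L_apply_le _).trans ih

/-- **Truncation of an `ℓ²` move**: `V_v a = Σ_{j ≤ N} a_j T^j v + T^{N+1} V_v(L^{N+1} a)` (iterate `Vy.V_decomp`).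
[cite: Enflo2023, v2 p.21] -/
theorem V_trunc [CompleteSpace H] (T : H →L[ℂ] H) (hT : ‖T‖ < 1) (v : H) (a : Vy.ℓ2) (N : ℕ) :
    Vy.V T hT v a = ∑ j ∈ Finset.range (N + 1), a j • (T ^ j) v +
      (T ^ (N + 1)) (Vy.V T hT v ((Vy.L ^ (N + 1)) a)) := by
  induction N with
  | zero =>
    rw [Finset.sum_range_one, pow_zero, one_apply_eq_self, zero_add, pow_one, pow_one]
    exact Vy.V_decomp T hT v a
  | succ N ih =>
    have h1 : ((Vy.L ^ (N + 1)) a) 0 = a (N + 1) := by rw [L_pow_apply, zero_add]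
    have h2 : Vy.L ((Vy.L ^ (N + 1)) a) = (Vy.L ^ (N + 1 + 1)) a := by
      rw [← mul_apply_eq_comp, ← pow_succ']
    have h3 : ∀ w : H, (T ^ (N + 1)) (T w) = (T ^ (N + 1 + 1)) w := fun w => by
      rw [← mul_apply_eq_comp, ← pow_succ]
    rw [ih, Vy.V_decomp T hT v ((Vy.L ^ (N + 1)) a), h1, h2, map_add, map_smul, h3,
      Finset.sum_range_succ _ (N + 1)]
    abel

/-- **Tail bound**: `‖T^{N+1} V_v(L^{N+1} a)‖ ≤ ‖T‖^{N+1} · ‖v‖(1 − ‖T‖²)^{-1/2} · ‖a‖` (the "terms of degree larger than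
`M'` contribute less than …" of v2 p.21). [cite: Enflo2023, v2 p.21] -/
theorem norm_V_tail_le [CompleteSpace H] (T : H →L[ℂ] H) (hT : ‖T‖ < 1) (v : H) (a : Vy.ℓ2) (N : ℕ) :
    ‖(T ^ (N + 1)) (Vy.V T hT v ((Vy.L ^ (N + 1)) a))‖ ≤
      ‖T‖ ^ (N + 1) * (‖v‖ * Real.sqrt (1 / (1 - ‖T‖ ^ 2))) * ‖a‖ := by
  calc ‖(T ^ (N + 1)) (Vy.V T hT v ((Vy.L ^ (N + 1)) a))‖
      ≤ ‖T‖ ^ (N + 1) * ‖Vy.V T hT v ((Vy.L ^ (N + 1)) a)‖ := Vy.norm_pow_apply_le T (N + 1) _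
    _ ≤ ‖T‖ ^ (N + 1) * ((‖v‖ * Real.sqrt (1 / (1 - ‖T‖ ^ 2))) * ‖(Vy.L ^ (N + 1)) a‖) := by
        gcongr
        exact (Vy.V T hT v).le_of_opNorm_le (Vy.norm_V_le T hT v) _
    _ ≤ ‖T‖ ^ (N + 1) * ((‖v‖ * Real.sqrt (1 / (1 - ‖T‖ ^ 2))) * ‖a‖) := by
        gcongr
        exact norm_L_pow_apply_le a (N + 1)
    _ = ‖T‖ ^ (N + 1) * (‖v‖ * Real.sqrt (1 / (1 - ‖T‖ ^ 2))) * ‖a‖ := by ring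

/-- The first `N + 1` coefficients of `a ∈ ℓ²`. [folklore] -/
noncomputable def trunc (N : ℕ) (a : Vy.ℓ2) : Fin (N + 1) → ℂ := fun j => a j

/-- `‖trunc N a‖_∞ ≤ ‖a‖_{ℓ²}`. [folklore] -/
lemma norm_trunc_le (N : ℕ) (a : Vy.ℓ2) : ‖trunc N a‖ ≤ ‖a‖ :=
  (pi_norm_le_iff_of_nonneg (norm_nonneg a)).2 fun j => lp.norm_apply_le_norm (by norm_num) a j

/-- The truncated polynomial move is the head of the `ℓ²` move. [folklore] -/
lemma polyOp_trunc_apply (T : H →L[ℂ] H) (N : ℕ) (a : Vy.ℓ2) (v : H) :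
    polyOp T N (trunc N a) v = ∑ j ∈ Finset.range (N + 1), a j • (T ^ j) v := by
  rw [polyOp_apply]
  exact Fin.sum_univ_eq_sum_range (fun j => a j • (T ^ j) v) (N + 1)

/-- **Large `L`, `ℓ²` moves** (the statement of v2 p.21, STEPS B17 (i) / referee S20): with `‖T‖ < 1`, the data of
`largeL_core`, `‖B y − x₀‖ ≤ 1/8` and (21) for `B` against all polynomial moves: if `L > 7‖B‖D` there is NO `M`
such that for every `n` some `a ∈ ℓ²` with `‖a‖ ≤ M` has `‖V_{y + L s_n} a − x₀‖ ≤ 0.3` — i.e. the minimal moves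
of `y + L s_n` into the `0.3`-ball have `‖ℓ_n‖₂ → ∞` along a subsequence.  (Truncate at a degree `N` with
`‖T‖^{N+1}(‖y‖ + LD)(1 − ‖T‖²)^{-1/2} M ≤ 1/10` and apply `largeL_poly`.)  The threshold `7‖B‖D` depends only on
`y, x₀, m` (through `B`) and `D` — NOT on `M` or `N`; this uniformity is the point the referee record S20 missed.
[cite: Enflo2023, v2 p.21] -/
theorem largeL_ell2 [CompleteSpace H] (T : H →L[ℂ] H) (hT : ‖T‖ < 1) {x₀ y : H} {s : ℕ → H} {D L : ℝ}
    {B : H →L[ℂ] H} (hx₀ : ‖x₀‖ = 1) (hsD : ∀ n, ‖s n‖ ≤ D)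
    (hs : ∀ v : H, Tendsto (fun n => ⟪v, s n⟫_ℂ) atTop (𝓝 0))
    (hB : ‖B y - x₀‖ ≤ 1 / 8)
    (h21 : ∀ (N : ℕ) (c : Fin (N + 1) → ℂ),
      Tendsto (fun n => ⟪B y, polyOp T N c y⟫_ℂ + ⟪B (s n), polyOp T N c (s n)⟫_ℂ) atTop (𝓝 0))
    (hL : 7 * (‖B‖ * D) < L) (M : ℝ) :
    ¬ ∀ n, ∃ a : Vy.ℓ2, ‖a‖ ≤ M ∧ ‖Vy.V T hT (y + (L : ℂ) • s n) a - x₀‖ ≤ 3 / 10 := by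
  intro hgood
  have hD : 0 ≤ D := (norm_nonneg _).trans (hsD 0)
  have hBD : 0 ≤ ‖B‖ * D := mul_nonneg (norm_nonneg _) hD
  have hL0 : 0 ≤ L := by linarith
  have hM : 0 ≤ M := by
    obtain ⟨a, ha, -⟩ := hgood 0
    exact (norm_nonneg _).trans ha
  set W : ℝ := ‖y‖ + L * D with hW_def
  have hvW : ∀ n, ‖y + (L : ℂ) • s n‖ ≤ W := fun n =>
    calc ‖y + (L : ℂ) • s n‖ ≤ ‖y‖ + ‖(L : ℂ) • s n‖ := norm_add_le _ _
      _ ≤ ‖y‖ + L * D := by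
          rw [norm_smul, Complex.norm_real, Real.norm_of_nonneg hL0]
          exact add_le_add le_rfl (mul_le_mul_of_nonneg_left (hsD n) hL0)
  have hW : 0 ≤ W := (norm_nonneg _).trans (hvW 0)
  set C : ℝ := W * Real.sqrt (1 / (1 - ‖T‖ ^ 2)) * M with hC_def
  have hC : 0 ≤ C := by rw [hC_def]; exact mul_nonneg (mul_nonneg hW (Real.sqrt_nonneg _)) hM
  have htend : Tendsto (fun k : ℕ => ‖T‖ ^ k * C) atTop (𝓝 0) := by
    have h := (tendsto_pow_atTop_nhds_zero_of_lt_one (norm_nonneg T) hT).mul_const C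
    rwa [zero_mul] at h
  obtain ⟨N₀, hN₀⟩ := eventually_atTop.1 (htend.eventually_lt_const (by norm_num : (0 : ℝ) < 1 / 10))
  have hN : ‖T‖ ^ (N₀ + 1) * C < 1 / 10 := hN₀ (N₀ + 1) (Nat.le_succ _)
  refine largeL_poly T hx₀ hsD hs hB N₀ (h21 N₀) hL M fun n => ?_
  obtain ⟨a, haM, ha⟩ := hgood n
  refine ⟨trunc N₀ a, (norm_trunc_le _ _).trans haM, ?_⟩
  set v : H := y + (L : ℂ) • s n with hv_def
  have hsplit : polyOp T N₀ (trunc N₀ a) v =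
      Vy.V T hT v a - (T ^ (N₀ + 1)) (Vy.V T hT v ((Vy.L ^ (N₀ + 1)) a)) := by
    rw [polyOp_trunc_apply, eq_sub_iff_add_eq, ← V_trunc]
  have htail : ‖(T ^ (N₀ + 1)) (Vy.V T hT v ((Vy.L ^ (N₀ + 1)) a))‖ ≤ 1 / 10 :=
    calc ‖(T ^ (N₀ + 1)) (Vy.V T hT v ((Vy.L ^ (N₀ + 1)) a))‖
        ≤ ‖T‖ ^ (N₀ + 1) * (‖v‖ * Real.sqrt (1 / (1 - ‖T‖ ^ 2))) * ‖a‖ := norm_V_tail_le T hT v a N₀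
      _ ≤ ‖T‖ ^ (N₀ + 1) * (W * Real.sqrt (1 / (1 - ‖T‖ ^ 2))) * M := by
          have h1 : ‖v‖ * Real.sqrt (1 / (1 - ‖T‖ ^ 2)) ≤ W * Real.sqrt (1 / (1 - ‖T‖ ^ 2)) :=
            mul_le_mul_of_nonneg_right (hvW n) (Real.sqrt_nonneg _)
          have h2 : 0 ≤ ‖T‖ ^ (N₀ + 1) := pow_nonneg (norm_nonneg _) _
          have h3 : 0 ≤ ‖v‖ * Real.sqrt (1 / (1 - ‖T‖ ^ 2)) := by positivity
          calc ‖T‖ ^ (N₀ + 1) * (‖v‖ * Real.sqrt (1 / (1 - ‖T‖ ^ 2))) * ‖a‖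
              ≤ ‖T‖ ^ (N₀ + 1) * (‖v‖ * Real.sqrt (1 / (1 - ‖T‖ ^ 2))) * M :=
                mul_le_mul_of_nonneg_left haM (mul_nonneg h2 h3)
            _ ≤ ‖T‖ ^ (N₀ + 1) * (W * Real.sqrt (1 / (1 - ‖T‖ ^ 2))) * M := by
                exact mul_le_mul_of_nonneg_right (mul_le_mul_of_nonneg_left h1 h2) hM
      _ = ‖T‖ ^ (N₀ + 1) * C := by rw [hC_def]; ring
      _ ≤ 1 / 10 := hN.le
  calc ‖polyOp T N₀ (trunc N₀ a) v - x₀‖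
      = ‖(Vy.V T hT v a - x₀) - (T ^ (N₀ + 1)) (Vy.V T hT v ((Vy.L ^ (N₀ + 1)) a))‖ := by
        rw [hsplit]; congr 1; abel
    _ ≤ ‖Vy.V T hT v a - x₀‖ + ‖(T ^ (N₀ + 1)) (Vy.V T hT v ((Vy.L ^ (N₀ + 1)) a))‖ := norm_sub_le _ _
    _ ≤ 3 / 10 + 1 / 10 := add_le_add ha htail
    _ = 2 / 5 := by norm_num

/-! ### Small `L`, and the threshold `L₀` (v2 pp.20–21) -/

/-- Polynomial approximants from an orbit closure: if `x ∈ orbitClosure A w` then some `p(A) w` is `η`-close to `x`.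
[folklore] -/
lemma exists_polyOp_near_of_mem_orbitClosure (A : H →L[ℂ] H) (w x : H) (hx : x ∈ orbitClosure A w)
    {η : ℝ} (hη : 0 < η) : ∃ (K : ℕ) (d : Fin (K + 1) → ℂ), ‖polyOp A K d w - x‖ ≤ η := by
  classical
  have hx' : x ∈ closure ((Submodule.span ℂ (Set.range fun j : ℕ => (A ^ j) w) : Submodule ℂ H) : Set H) := by
    rw [← Submodule.topologicalClosure_coe]; exact hx
  obtain ⟨u, hu, hdist⟩ := Metric.mem_closure_iff.1 hx' η hη
  obtain ⟨c, rfl⟩ := Finsupp.mem_span_range_iff_exists_finsupp.1 (SetLike.mem_coe.1 hu)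
  set K : ℕ := c.support.sup id with hK_def
  refine ⟨K, fun i => c i, ?_⟩
  have hsub : c.support ⊆ Finset.range (K + 1) := fun i hi =>
    Finset.mem_range.2 (Nat.lt_succ_of_le (Finset.le_sup (f := id) hi))
  have hsum : polyOp A K (fun i => c i) w = c.sum fun i a => a • (A ^ i) w := by
    rw [polyOp_apply, Finsupp.sum_of_support_subset c hsub (fun i a => a • (A ^ i) w) (fun i _ => zero_smul ℂ _)]
    exact Fin.sum_univ_eq_sum_range (fun i => c i • (A ^ i) w) (K + 1)
  rw [hsum, ← dist_eq_norm, dist_comm]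
  exact hdist.le

/-- The finitely supported coefficient sequence `Σ_{i ≤ K} d_i e_i ∈ ℓ²`. [folklore] -/
noncomputable def coeffSeq (K : ℕ) (d : Fin (K + 1) → ℂ) : Vy.ℓ2 := ∑ i : Fin (K + 1), d i • lp.single 2 (i : ℕ) (1 : ℂ)

/-- `V_v (Σ d_i e_i) = Σ d_i T^i v = p_d(T) v`. [cite: Enflo2023, v2 p.2, eq. (2)] -/
lemma V_coeffSeq [CompleteSpace H] (T : H →L[ℂ] H) (hT : ‖T‖ < 1) (v : H) (K : ℕ) (d : Fin (K + 1) → ℂ) :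
    Vy.V T hT v (coeffSeq K d) = polyOp T K d v := by
  rw [coeffSeq, map_sum, polyOp_apply]
  refine Finset.sum_congr rfl fun i _ => ?_
  rw [map_smul, Vy.V_single]

/-- **Small `L`** (v2 p.21: "`L₀ > 0`, since if `‖ℓ'(T) y₀ − x₀‖ ≤ 0.2` then `‖ℓ'(T)(y₀' + L s_n) − x₀‖ < 0.3` if
`L < 0.1/(D‖ℓ'(T)‖)`"): one fixed finitely supported move works for all `n`, with the uniform bound `‖Σ d_i e_i‖`.
[cite: Enflo2023, v2 p.21] -/
theorem smallL_moves [CompleteSpace H] (T : H →L[ℂ] H) (hT : ‖T‖ < 1) {x₀ y : H} {s : ℕ → H} {D : ℝ}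
    (hsD : ∀ n, ‖s n‖ ≤ D) {K : ℕ} {d : Fin (K + 1) → ℂ} (hd : ‖polyOp T K d y - x₀‖ ≤ 1 / 5) {L : ℝ}
    (hL0 : 0 ≤ L) (hL : L * (‖polyOp T K d‖ * D) ≤ 1 / 10) (n : ℕ) :
    ∃ a : Vy.ℓ2, ‖a‖ ≤ ‖coeffSeq K d‖ ∧ ‖Vy.V T hT (y + (L : ℂ) • s n) a - x₀‖ ≤ 3 / 10 := by
  refine ⟨coeffSeq K d, le_rfl, ?_⟩
  rw [V_coeffSeq, map_add, map_smul]
  calc ‖polyOp T K d y + (L : ℂ) • polyOp T K d (s n) - x₀‖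
      = ‖(polyOp T K d y - x₀) + (L : ℂ) • polyOp T K d (s n)‖ := by congr 1; abel
    _ ≤ ‖polyOp T K d y - x₀‖ + ‖(L : ℂ) • polyOp T K d (s n)‖ := norm_add_le _ _
    _ ≤ 1 / 5 + L * (‖polyOp T K d‖ * D) := by
        refine add_le_add hd ?_
        rw [norm_smul, Complex.norm_real, Real.norm_of_nonneg hL0]
        refine mul_le_mul_of_nonneg_left ?_ hL0
        exact (ContinuousLinearMap.le_opNorm _ _).trans (mul_le_mul_of_nonneg_left (hsD n) (norm_nonneg _))
    _ ≤ 3 / 10 := by linarith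

/-- `Good(L)` of v2 pp.20–21: the minimal `ℓ²` moves of `y + L s_n` into the `0.3`-ball around `x₀` are bounded
uniformly in `n` — stated without minimisers as "for some `M`, every `n` admits a move of norm `≤ M`", which is
equivalent. [cite: Enflo2023, v2 p.20] -/
def MovesBounded [CompleteSpace H] (T : H →L[ℂ] H) (hT : ‖T‖ < 1) (x₀ y : H) (s : ℕ → H) (L : ℝ) : Prop :=
  ∃ M : ℝ, ∀ n, ∃ a : Vy.ℓ2, ‖a‖ ≤ M ∧ ‖Vy.V T hT (y + (L : ℂ) • s n) a - x₀‖ ≤ 3 / 10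

/-- **The threshold `L₀` of the type-2 section exists** (v2 pp.20–21, STEPS B17 (i)–(ii) / referee S20, CLOSED):
for `‖T‖ < 1` with `T†` injective (WLOG: else `T` has non-dense range and a n.i.s., `Reductions.lean`), a unit
vector `x₀`, `y ≠ 0`, a bounded weakly null `s n` and (20) from degree `m` on, EITHER `T` has a non-trivial closed
invariant subspace (the orbit of `y` under `T`, or of `(T†)^m y` under `T†`, is not dense), OR there is `L₀ > 0`
with `Good(L)` for all `0 < L < L₀` and `¬Good(L)` for `L ≥ L₀` arbitrarily close to `L₀` — the form of the
threshold the sequel (47) uses (`Type2Threshold.lean` records why the text's monotone wording "no such `M` for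
`L > L₀`" is more than is proved or needed).  Ingredients: `smallL_moves`, `largeL_ell2` at `L = 7‖B‖D + 1`,
`threshold_pos`. [cite: Enflo2023, v2 pp.20–21] -/
theorem type2_threshold_or_NIS [CompleteSpace H] (T : H →L[ℂ] H) (hT : ‖T‖ < 1)
    (hTinj : Function.Injective (ContinuousLinearMap.adjoint T)) (m : ℕ) {x₀ y : H} {s : ℕ → H} {D : ℝ}
    (hx₀ : ‖x₀‖ = 1) (hy : y ≠ 0) (hsD : ∀ n, ‖s n‖ ≤ D)
    (hs : ∀ v : H, Tendsto (fun n => ⟪v, s n⟫_ℂ) atTop (𝓝 0))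
    (h20 : ∀ j, m ≤ j → Tendsto (fun n => ⟪y, (T ^ j) y⟫_ℂ + ⟪s n, (T ^ j) (s n)⟫_ℂ) atTop (𝓝 0)) :
    HasNontrivialClosedInvariantSubspace T ∨
      ∃ L₀ : ℝ, 0 < L₀ ∧ (∀ L, 0 < L → L < L₀ → MovesBounded T hT x₀ y s L) ∧
        ∀ δ > 0, ∃ L, L₀ ≤ L ∧ L < L₀ + δ ∧ 0 < L ∧ ¬ MovesBounded T hT x₀ y s L := by
  classical
  -- the cyclic approximant of `x₀` from the `T`-orbit of `y`, or a n.i.s.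
  by_cases hnc : IsNonCyclic T y
  · exact Or.inl (hasNontrivialClosedInvariantSubspace_of_isNonCyclic T hy hnc)
  have hx₀mem : x₀ ∈ orbitClosure T y := by
    have htop : orbitClosure T y = ⊤ := not_ne_iff.1 hnc
    rw [htop]; exact Submodule.mem_top
  obtain ⟨K₀, d₀, hd₀⟩ := exists_polyOp_near_of_mem_orbitClosure T y x₀ hx₀mem (by norm_num : (0 : ℝ) < 1 / 5)
  -- the test operator from the `T†`-orbit of `(T†)^m y`, or a n.i.s.
  set A : H →L[ℂ] H := ContinuousLinearMap.adjoint T with hA_def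
  set w : H := (A ^ m) y with hw_def
  have hw : w ≠ 0 := by
    have hinj : Function.Injective (A ^ m) := by
      rw [ContinuousLinearMap.coe_pow']
      exact hTinj.iterate m
    intro h0
    exact hy (hinj (h0.trans (map_zero (A ^ m)).symm))
  by_cases hncA : IsNonCyclic A w
  · exact Or.inl (hasNontrivialClosedInvariantSubspace_of_adjoint T
      (hasNontrivialClosedInvariantSubspace_of_isNonCyclic A hw hncA))
  have hx₀A : x₀ ∈ orbitClosure A w := by
    have htop : orbitClosure A w = ⊤ := not_ne_iff.1 hncA
    rw [htop]; exact Submodule.mem_top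
  obtain ⟨K, d, hd⟩ := exists_polyOp_near_of_mem_orbitClosure A w x₀ hx₀A (by norm_num : (0 : ℝ) < 1 / 8)
  have hB : ‖testOp T m K d y - x₀‖ ≤ 1 / 8 := by rw [testOp_apply]; exact hd
  right
  -- the threshold
  have hD : 0 ≤ D := (norm_nonneg _).trans (hsD 0)
  have hQD : 0 ≤ ‖polyOp T K₀ d₀‖ * D := mul_nonneg (norm_nonneg _) hD
  have hBD : 0 ≤ ‖testOp T m K d‖ * D := mul_nonneg (norm_nonneg _) hD
  obtain ⟨ε, hε_def⟩ : ∃ ε : ℝ, ε = 1 / (10 * (‖polyOp T K₀ d₀‖ * D + 1)) := ⟨_, rfl⟩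
  have h10 : (0 : ℝ) < 10 * (‖polyOp T K₀ d₀‖ * D + 1) := by linarith
  have hε : 0 < ε := by rw [hε_def]; exact div_pos one_pos h10
  refine threshold_pos (MovesBounded T hT x₀ y s) ε hε (fun L hL0 hLε => ?_)
    (7 * (‖testOp T m K d‖ * D) + 1) (by linarith) ?_
  · refine ⟨‖coeffSeq K₀ d₀‖, fun n => smallL_moves T hT hsD hd₀ hL0.le ?_ n⟩
    have h1 : L * (‖polyOp T K₀ d₀‖ * D) ≤ ε * (‖polyOp T K₀ d₀‖ * D) := mul_le_mul_of_nonneg_right hLε.le hQD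
    have h2 : ε * (‖polyOp T K₀ d₀‖ * D + 1) = 1 / 10 := by
      rw [hε_def, div_mul_eq_mul_div, one_mul, div_eq_iff h10.ne']
      ring
    have h3 : ε * (‖polyOp T K₀ d₀‖ * D) ≤ ε * (‖polyOp T K₀ d₀‖ * D + 1) :=
      mul_le_mul_of_nonneg_left (by linarith) hε.le
    linarith
  · rintro ⟨M, hM⟩
    exact largeL_ell2 T hT hx₀ hsD hs hB (fun N c => eq21_of_eq20 T m h20 K d N c) (by linarith) M hM

/-- **End to end from the definition of type 2** (v2 p.7 + pp.20–21): for `‖T‖ < 1` with `T†` injective, `T` of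
type 2 (`Referee.Type2`) with its unit vector `u₀`, and ANY unit vector `x₀`: either `T` has a non-trivial closed
invariant subspace, or there are `m ≥ 1`, the weak limit `y = y'_∞ ≠ 0` (`‖y‖ ≤ 1`, `Re⟨y, u₀⟩ ≥ 1/100`), the weakly
null `s_n` (`‖s_n‖ ≤ 2`) with (20), and the threshold `L₀ > 0` of the type-2 section for the `ℓ²` moves of
`y + L s_n` into the `0.3`-ball at `x₀`.  (`eq20_of_type2` + `type2_threshold_or_NIS`.)  This is the input of (47);
nothing beyond p.21 is asserted. [cite: Enflo2023, v2 pp.7, 20–21] -/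
theorem threshold_or_NIS_of_type2 [CompleteSpace H] (T : H →L[ℂ] H) (hT : ‖T‖ < 1)
    (hTinj : Function.Injective (ContinuousLinearMap.adjoint T)) (hT2 : Referee.Type2 T)
    (u₀ : H) (hu₀ : ‖u₀‖ = 1) (x₀ : H) (hx₀ : ‖x₀‖ = 1) :
    HasNontrivialClosedInvariantSubspace T ∨
      ∃ (m : ℕ) (y : H) (s : ℕ → H), 1 ≤ m ∧ y ≠ 0 ∧ ‖y‖ ≤ 1 ∧ (1 / 100 : ℝ) ≤ re ⟪u₀, y⟫_ℂ ∧
        (∀ n, ‖s n‖ ≤ 2) ∧ (∀ v : H, Tendsto (fun n => ⟪v, s n⟫_ℂ) atTop (𝓝 0)) ∧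
        (∀ j, m ≤ j → Tendsto (fun n => ⟪y, (T ^ j) y⟫_ℂ + ⟪s n, (T ^ j) (s n)⟫_ℂ) atTop (𝓝 0)) ∧
        ∃ L₀ : ℝ, 0 < L₀ ∧ (∀ L, 0 < L → L < L₀ → MovesBounded T hT x₀ y s L) ∧
          ∀ δ > 0, ∃ L, L₀ ≤ L ∧ L < L₀ + δ ∧ 0 < L ∧ ¬ MovesBounded T hT x₀ y s L := by
  obtain ⟨m, y, s, hm, hy1, hre, hy0, hs2, hs, h20⟩ := eq20_of_type2 T hT2 u₀ hu₀
  rcases type2_threshold_or_NIS T hT hTinj m hx₀ hy0 hs2 hs h20 with h | h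
  · exact Or.inl h
  · exact Or.inr ⟨m, y, s, hm, hy0, hy1, hre, hs2, hs, h20, h⟩

end Type2

end Literature.Analysis.OperatorTheory.Enflo2023
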